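import Literature.MathematicalPhysics.QuantumFieldTheory.QCDTransferMatrix

/-!
# Cyclic undressing of the time-slice product inside `det (1 − s · ∏)`
(helper for crux stmt-QuantumFields-9737 `QuarksAsStableAction.StableActionBridge`, line `Sketch`;
stub `det_one_sub_smul_prod_dressed`)

In the time-slice reduction of the Wilson fermion determinant,
`det D_W = ∏_t det E_t · det (1 − (−1)^L ∏_{i<L} E_i⁻¹ F_i)` (slices labelled by `ZMod L`, the
product being `((List.range L).map …).prod`), each one-step matrix is a core `M_i` dressed by the
temporal transporters `G_i`:
`−E_i⁻¹ F_i = (G_{i−1} P₊ + P₋) · M_i · (P₊ + G_i P₋)`,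
where `P₊ + P₋ = 1` are complementary projections (`P₊² = P₊`, `P₋² = P₋`, `P₊ P₋ = P₋ P₊ = 0`)
commuting with every `G_i`.

* `CyclicUndressing.rightDress_mul_leftDress` — the seam identity
  `(P₊ + G P₋)(G P₊ + P₋) = G P₊ + G P₋ = G`;
* `CyclicUndressing.prod_range_succ_dressed` — hence the dressed product telescopes:
  `∏_{i<k+1} (G_{i−1} P₊ + P₋) M_i (P₊ + G_i P₋) = (G_{−1} P₊ + P₋) · (∏_{i<k} M_i G_i) · M_k · (P₊ + G_k P₋)`;
* `det_one_sub_smul_prod_dressed` — for `L = k + 1` the last seam closes cyclically under the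
  determinant, by Sylvester's (Weinstein–Aronszajn) identity `det (1 − A B) = det (1 − B A)`
  (`Matrix.det_one_sub_mul_comm`) and `G_{0−1} = G_k` in `ZMod (k + 1)`:
  `det (1 − s · ∏_{i<L} (G_{i−1} P₊ + P₋) M_i (P₊ + G_i P₋)) = det (1 − s · ∏_{i<L} M_i G_i)`.

Pure Mathlib matrix algebra; pure theorem file (no definitions).
-/

namespace Summit.QuantumFields.QCD.Cruxes.StableActionBridge.Sketch

open scoped ComplexOrder
open Literature.MathematicalPhysics.QuantumFieldTheory Literature.MathematicalPhysics.QuantumLattice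

namespace CyclicUndressing

variable {n : Type*} [Fintype n] [DecidableEq n]

/-- **Seam identity.** For complementary projections `P₊ + P₋ = 1` (`P₊² = P₊`, `P₋² = P₋`,
`P₊ P₋ = P₋ P₊ = 0`) commuting with `G`:
`(P₊ + G P₋)(G P₊ + P₋) = G P₊ + P₊ P₋ + G² P₋ P₊ + G P₋ = G (P₊ + P₋) = G`. -/
theorem rightDress_mul_leftDress (Pp Pm G : Matrix n n ℂ) (hsum : Pp + Pm = 1)
    (hPp : Pp * Pp = Pp) (hPm : Pm * Pm = Pm) (hpm : Pp * Pm = 0) (hmp : Pm * Pp = 0)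
    (hGp : G * Pp = Pp * G) (hGm : G * Pm = Pm * G) :
    (Pp + G * Pm) * (G * Pp + Pm) = G := by
  have h1 : Pp * (G * Pp) = G * Pp := by
    rw [← Matrix.mul_assoc, ← hGp, Matrix.mul_assoc, hPp]
  have h2 : G * Pm * (G * Pp) = 0 := by
    rw [Matrix.mul_assoc, ← Matrix.mul_assoc Pm G Pp, ← hGm, Matrix.mul_assoc G Pm Pp, hmp,
      Matrix.mul_zero, Matrix.mul_zero]
  have h3 : G * Pm * Pm = G * Pm := by
    rw [Matrix.mul_assoc, hPm]
  rw [add_mul, mul_add, mul_add, h1, hpm, h2, h3, add_zero, zero_add, ← mul_add, hsum,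
    Matrix.mul_one]

/-- **Telescoping of the dressed product.** With `X_i = (G_{i−1} P₊ + P₋) M_i (P₊ + G_i P₋)`
(indices `i : ℕ` read in `ZMod L`), for every `k`,
`∏_{i<k+1} X_i = (G_{0−1} P₊ + P₋) · (∏_{i<k} M_i G_i) · M_k · (P₊ + G_k P₋)`:
consecutive factors meet in the seam `(P₊ + G_i P₋)(G_i P₊ + P₋) = G_i`. -/
theorem prod_range_succ_dressed (L : ℕ) (Pp Pm : Matrix n n ℂ) (M G : ZMod L → Matrix n n ℂ)
    (hsum : Pp + Pm = 1) (hPp : Pp * Pp = Pp) (hPm : Pm * Pm = Pm) (hpm : Pp * Pm = 0)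
    (hmp : Pm * Pp = 0) (hGp : ∀ t, G t * Pp = Pp * G t) (hGm : ∀ t, G t * Pm = Pm * G t)
    (k : ℕ) :
    ((List.range (k + 1)).map fun i : ℕ =>
        (G ((i : ZMod L) - 1) * Pp + Pm) * M i * (Pp + G i * Pm)).prod =
      (G (((0 : ℕ) : ZMod L) - 1) * Pp + Pm) * ((List.range k).map fun i : ℕ => M i * G i).prod *
        M k * (Pp + G k * Pm) := by
  induction k with
  | zero =>
    rw [List.prod_range_succ, List.range_zero, List.map_nil, List.map_nil, List.prod_nil, one_mul,
      Matrix.mul_one]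
  | succ k ih =>
    rw [List.prod_range_succ, ih, List.prod_range_succ]
    have hk : (((k + 1 : ℕ) : ZMod L) - 1) = (k : ZMod L) := by
      push_cast
      ring
    rw [hk]
    simp only [Matrix.mul_assoc]
    rw [← Matrix.mul_assoc (Pp + G k * Pm) (G k * Pp + Pm),
      rightDress_mul_leftDress Pp Pm (G k) hsum hPp hPm hpm hmp (hGp k) (hGm k)]

/-- **Sylvester's identity under a scalar**: `det (1 − s · A B) = det (1 − s · B A)`
(Weinstein–Aronszajn, `Matrix.det_one_sub_mul_comm`, with `s · (A B) = A (s · B)`). -/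
theorem det_one_sub_smul_mul_comm (s : ℂ) (A B : Matrix n n ℂ) :
    (1 - s • (A * B)).det = (1 - s • (B * A)).det := by
  rw [← Matrix.mul_smul, Matrix.det_one_sub_mul_comm, Matrix.smul_mul]

end CyclicUndressing

/-- **Cyclic undressing of the slice product under `det (1 − s · ∏)`** (stub
`det_one_sub_smul_prod_dressed` of line `Sketch`). For complementary projections `P₊ + P₋ = 1`
(`P₊² = P₊`, `P₋² = P₋`, `P₊ P₋ = P₋ P₊ = 0`) commuting with all temporal transporters `G_t`
(`t : ZMod L`, `L ≥ 1`), every family of cores `M_t` and every scalar `s`,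
`det (1 − s · ∏_{i<L} (G_{i−1} P₊ + P₋) M_i (P₊ + G_i P₋)) = det (1 − s · ∏_{i<L} M_i G_i)`:
the dressed product telescopes through the seams `(P₊ + G_i P₋)(G_i P₊ + P₋) = G_i` to
`(G_{L−1} P₊ + P₋) · (∏_{i<L−1} M_i G_i) · M_{L−1} · (P₊ + G_{L−1} P₋)`, and the last seam closes
cyclically by Sylvester's identity `det (1 − A B) = det (1 − B A)`. -/
theorem det_one_sub_smul_prod_dressed :
    ∀ (n : Type) [Fintype n] [DecidableEq n] (L : ℕ) [NeZero L] (s : ℂ) (Pp Pm : Matrix n n ℂ)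
      (M G : ZMod L → Matrix n n ℂ),
      Pp + Pm = 1 → Pp * Pp = Pp → Pm * Pm = Pm → Pp * Pm = 0 → Pm * Pp = 0 →
      (∀ t, G t * Pp = Pp * G t) → (∀ t, G t * Pm = Pm * G t) →
      (1 - s • ((List.range L).map fun i : ℕ =>
          (G ((i : ZMod L) - 1) * Pp + Pm) * M i * (Pp + G i * Pm)).prod).det =
        (1 - s • ((List.range L).map fun i : ℕ => M i * G i).prod).det := by
  intro n _ _ L _ s Pp Pm M G hsum hPp hPm hpm hmp hGp hGm
  obtain ⟨k, rfl⟩ := Nat.exists_eq_add_one_of_ne_zero (NeZero.ne L)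
  have hcast : ((0 : ℕ) : ZMod (k + 1)) - 1 = ((k : ℕ) : ZMod (k + 1)) := by
    rw [Nat.cast_zero, zero_sub, eq_comm, eq_neg_iff_add_eq_zero]
    exact ZMod.natCast_self' k
  rw [CyclicUndressing.prod_range_succ_dressed (k + 1) Pp Pm M G hsum hPp hPm hpm hmp hGp hGm k,
    hcast, List.prod_range_succ, Matrix.mul_assoc, Matrix.mul_assoc,
    CyclicUndressing.det_one_sub_smul_mul_comm, Matrix.mul_assoc, Matrix.mul_assoc,
    CyclicUndressing.rightDress_mul_leftDress Pp Pm (G k) hsum hPp hPm hpm hmp (hGp k) (hGm k)]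

end Summit.QuantumFields.QCD.Cruxes.StableActionBridge.Sketch
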